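/-
Copyright (c) 2026 the pub-hodgecm-mathlib formalisation cell (harness21).  Prover seat hodgecm-mathlib-LH4-p06 (g9), req620 Track A «(D-RAM) FOUR-FRAME» squad
F0∕P3c∕LH4; the (β₂) road (R-36) «PURE-CELL LEDGER», β₂ WORD #27 (a)∕#28 (a) of the sub-dealer LH4-p04 (g10): piece ‹D0›, file D0-3 = socket ‹Z-SH› «THE SHELLS OF THE
DIAGONAL CELL AT THE EIGENVALUE GAP δ = 0» (the `δ = 0` twin of ★ p863084 `F0P3cDyRamRowCellOnShell`); helper lane on h413 = stmt-HodgeConjecture-24833 (count-neutral).  2026-09-05.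
-/
import Summits.HodgeConjecture.HodgeConjecture.Theorems.F0P3cDyRamRowCellOnShell                 -- ★ p863084 (this seat): `uniformizer_letters`, `isOrd_div_of_row`, `isOrd_sub_one_of_row`; brings ★ `…ShellLineModel` (the shell∕level `iff_isOrd`), ★ p861810, ★ DEFS
import Literature.NumberTheory.LocalFields.QuadraticOrderNormDepthIndexTwoRamified            -- ★ (F0P3-p01 lineage): `v_sub_map_le_mul_pow` (`|t − Θt| ≤ |t|·|ϖ|^{d−1}`)
import HarnessLib

/-!
# Crux `H413`, line LH4 «(D-RAM) FOUR-FRAME» — STAGE-1b, row (2), the (β₂) road (R-36), lane B, piece ‹D0› (β₂ WORD #24∕#27∕#28), file D0-3 = socket ‹Z-SH›: «AT THE GAP δ = 0 A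
# DIAGONAL-CELL VERTEX IS ON THE `(0, k)`-SHELL IFF ITS LETTER SCALAR IS A UNIT; ON THE X-DIGIT IT LIES IN LEVEL 1 (OFF BOTH SHELLS)»

Cell `hodgecm-mathlib` (D-0151), FLOOR 0, crux item H413 = `stmt-HodgeConjecture-24833`, route of record `HCCMUnconditional`; squad F0∕P3c∕LH4; lane
`--supports stmt-HodgeConjecture-24833 --as helper` (count-neutral; pays NO tier-0 row).  THEOREMS ONLY (no `def`, no instance, no notation, no `sorry`, default heartbeats);
★-only imports; states NO law; (β₂) stays a HYPOTHESIS.  Frame = ★ p863084 HEAD `latticeNearTransvShell_zero_of_row`'s glued-vertex letters VERBATIM (plane `E`, `|ϖ| = exp(−1)`,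
line model `(M, jE, ρ, α; φ, lam)`, vertex `L` with tube `b` over `(B₂, w₀, g₀)`, `Λ = φ(B₂) = x₀·𝒪_cc`, `φ w₀ = Y⁻¹x₀`, CELL `hYO hYprim hYb`, `|u₀₀ − 1| ≤ |ϖ|^{n_u}`,
`|2| ≤ |ϖ|^t`, `|μ| = |ϖE|^{2b}`), with ★ p863084's `hanti` (`b + 1`: STRICTLY inside the anti-diagonal) replaced by the BOUNDARY letter `|μ − ρμ| ≤ |cc(α − ρα)|·|ϖE|^b` — which
at the gap `δ = 0` on the diagonal (`cc = ϖE^b`, `|μ − ρμ| = |μ| = |ϖE|^{2b}`) holds with EQUALITY — plus `ρ cc = cc`, `|cc| = |ϖE|^b`, the second involution `Θ` commuting with `ρ`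
(isometric), the RamK datum `IsRamifiedQuadraticDatum Θ (jE ϖ) d t_M` on `M` with `2 ≤ d`, and the LETTER SCALAR `Tr_ρ(μ∕D₀)`, `D₀ = cc(α − ρα)·ΘY` (★ `…LetterBalanced` §2, ★ K3).

WHY (LH4-p15 (g2) 2026-09-05 00:31:41Z (c) «X-top-digit members are `LatticeInLevel ϖ 1 (Γ − 1)`»; this seat's SIG 01:04Z∕01:14Z).  By ★ `…ShellLineModel`'s `iff_isOrd`
characterisations the `(0, k)`-shell of `Γ − 1 = endoGL (γ₂, u) − 1` at a glued vertex is three order clauses at level `0`, the NEGATION of the three at level `1`, and two square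
clauses at level `k`.  ★ p863084 discharged them strictly inside the anti-diagonal; AT the gap `δ = 0` everything survives with the boundary letter (§2–§3: the level-0 clauses and
the square clauses are re-derived with exponent `b`) EXCEPT the strictness clause `¬ IsOrd ρ α cc (μ∕(ϖE·Y))`: ★ p863084's `not_isOrd_div_mul_of_row` used the extra digit.  §1 is
the replacement: `μ·ρY − ρμ·Y` and `μ·Θ(ρY) − ρμ·ΘY` differ by `|μ|·|ΘY − Y| ≤ |ϖE|^{3b+1}` (the RamK involution moves `Y` by a digit, `d ≥ 2`), so «`μ∕(ϖE·Y) ∈ 𝒪_cc`» (level 1)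
is EQUIVALENT to «`|Tr_ρ(μ∕D₀)| < 1`» (the letter scalar drops — the X-DIGIT of ★ D0-1∕D0-2).  HEADS (§4): off the X-digit the vertex is on the `(0, k)`-shell for every admissible
`k` (`k ≤ 2b`, `2n_u`, `b + n_u`, `t + n_u` — so `k = m*` and `k = m_c` on the fence); on the X-digit it is in level `1`, hence on NO `(0, k)`-shell.
* §1 `isOrd_div_mul_iff_v_trace_lt_one` — `IsOrd ρ α cc (μ∕(ϖE·Y)) ↔ |μ∕D₀ + ρ(μ∕D₀)| < 1`.
* §2 `isOrd_sq_div_of_antiRow`, `isOrd_sqDiff_div_of_antiRow` — ★ p863084 §3's square clauses with the boundary letter (exponent `b`; `k ≤ b + n_u`).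
* §3 `isOrd_sub_one_div_of_deep` — `(lam − 1)∕ϖE ∈ 𝒪_cc` from `|μ| ≤ |ϖE|^{2b}`, `|u₀₀ − 1| ≤ |ϖ|^{n_u}`, `1 ≤ b`, `1 ≤ n_u`, boundary letter.
* §4 HEADS `latticeNearTransvShell_zero_of_gap_zero` (unit scalar ⇒ `(0,k)`-shell) and `latticeInLevel_one_of_gap_zero` ∕ `not_latticeNearTransvShell_zero_of_gap_zero` (scalar
  drops ⇒ level 1 ⇒ no `(0,k)`-shell).
WHAT IS NOT CLAIMED: the label read (★ D0-2), the digit count (‹Z-CNT›), any cell law.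
HONEST LABEL.  Count-neutral lattice bookkeeping; nothing printed is asserted; ‹D0› OPEN; `HC_CM` is proved only modulo the 7 printed citations (2 remaining named inputs:
hLiu418 = `stmt-HodgeConjecture-24832`, h413 = `stmt-HodgeConjecture-24833`) until rung 0 closes.
## References
* [Kottwitz1986BaseChangeUnits] R. E. Kottwitz, *Base change for unit elements of Hecke algebras*, Compositio Math. 60 (1986): §1 pp. 240–241, §3.
* [Serre1979] J.-P. Serre, *Local Fields*, GTM 67 (1979): Ch. III §6 Prop. 12; Ch. IV §1 Prop. 3 (`i_G` of an involution).
* [Jacobowitz1962] R. Jacobowitz, *Hermitian forms over local fields*, Amer. J. Math. 84 (1962): §4.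
* [Rogawski1990] J. D. Rogawski, *Automorphic Representations of Unitary Groups in Three Variables*, Ann. of Math. Stud. 123 (1990): §4.9 Prop. 4.9.1 (b) p. 55.
-/

set_option autoImplicit false

noncomputable section

namespace Summit.HodgeConjecture.HodgeConjecture.Cruxes.H413.F0P3cDyRamDiagonalCellShellsDeltaZero

open scoped Valued WithZero Matrix MatrixGroups
open WithZero
open Literature.NumberTheory.Automorphic Literature.NumberTheory.Automorphic.HermitianLattice Literature.NumberTheory.Automorphic.UnitaryLatticeTree
open Literature.NumberTheory.Automorphic.UnitaryThreeFourFrame (IsRamifiedQuadraticDatum)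
open Literature.NumberTheory.Rogawski1990
open Literature.NumberTheory.LocalFields.QuadraticOrder (v_sub_map_le_mul_pow)
open Summit.HodgeConjecture.HodgeConjecture.Cruxes.H413.F0P3cDyRamToricCensusDefs
open Summit.HodgeConjecture.HodgeConjecture.Cruxes.H413.F0P3cDyRamFourFrameCensusDefs (LatticeInLevel LatticeNearTransvShell)
open Summit.HodgeConjecture.HodgeConjecture.Cruxes.H413.F0P3cDyRamShellLineModel (latticeNearTransvShell_endoGL_sub_one_iff_isOrd latticeInLevel_endoGL_sub_one_iff_isOrd)
open Summit.HodgeConjecture.HodgeConjecture.Cruxes.H413.F0P3cDyRamRayDominatedCellLetter (v_map_le_map_pow_of_le)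
open Summit.HodgeConjecture.HodgeConjecture.Cruxes.H413.F0P3cDyRamRowCellOnShell (uniformizer_letters isOrd_div_of_row isOrd_sub_one_of_row)

variable {E M : Type} [Field E] [Valued E ℤᵐ⁰] [Field M] [Valued M ℤᵐ⁰] {ρ Θ : M →+* M} {α : M}

/-! ## §1 At the gap `δ = 0`: «level 1» ⟺ «the letter scalar drops» -/

omit [Field E] [Valued E ℤᵐ⁰] in
/-- **THE X-DIGIT IS THE LEVEL-1 CLAUSE.**  `ρ`, `Θ` commuting isometric involutions of `M` (`ρ` involutive), `ρϖM = ϖM`, `|ϖM| = exp(−1)`; `cc` with `ρcc = cc`, `|cc| = |ϖM|^b`,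
`1 ≤ b`; `|α − ρα| = 1`; the cell member `|Y| = |ϖM|^b` with `|ΘY − Y| ≤ |Y|·|ϖM|` (RamK involution, `d ≥ 2`); the gap-zero depth `|μ| = |ϖM|^{2b}`.  THEN
`IsOrd ρ α cc (μ∕(ϖM·Y)) ↔ |μ∕(cc(α − ρα)ΘY) + ρ(μ∕(cc(α − ρα)ΘY))| < 1`: both sides read `|μ·ρY′ − ρμ·Y′| < |ϖM|^{3b}` for `Y′ = Y` resp. `Y′ = ΘY`, and the two numerators
differ by at most `|μ|·|ΘY − Y| ≤ |ϖM|^{3b+1}`. [cite: Serre1979, Ch. III §6 Prop. 12; Ch. IV §1 Prop. 3] [cite: Jacobowitz1962, §4] -/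
theorem isOrd_div_mul_iff_v_trace_lt_one (hρρ : ∀ x, ρ (ρ x) = x) (hvρ : ∀ x, Valued.v (ρ x) = Valued.v x)
    (hΘρ : ∀ x, Θ (ρ x) = ρ (Θ x)) (hvΘ : ∀ x, Valued.v (Θ x) = Valued.v x)
    {ϖM cc Y μ : M} (hρϖ : ρ ϖM = ϖM) (hϖM : Valued.v ϖM = exp (-1 : ℤ)) (hρcc : ρ cc = cc) {b : ℕ} (hb1 : 1 ≤ b)
    (hccv : Valued.v cc = Valued.v ϖM ^ b) (hU : Valued.v (α - ρ α) = 1) (hYv : Valued.v Y = Valued.v ϖM ^ b)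
    (hΘY : Valued.v (Θ Y - Y) ≤ Valued.v Y * Valued.v ϖM) (hμv : Valued.v μ = Valued.v ϖM ^ (2 * b)) :
    IsOrd ρ α cc (μ / (ϖM * Y)) ↔ Valued.v (μ / (cc * (α - ρ α) * Θ Y) + ρ (μ / (cc * (α - ρ α) * Θ Y))) < 1 := by
  have hvϖ0 : Valued.v ϖM ≠ 0 := by rw [hϖM]; exact exp_ne_zero
  have hϖ0 : ϖM ≠ 0 := fun h0 => by rw [h0, map_zero] at hvϖ0; exact hvϖ0 rfl
  have hvϖpos : 0 < Valued.v ϖM := zero_lt_iff.2 hvϖ0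
  have hϖle : Valued.v ϖM ≤ 1 := by rw [hϖM, ← exp_zero, exp_le_exp]; norm_num
  have hπn : ∀ n : ℕ, Valued.v ϖM ^ n = exp (-(n : ℤ)) := fun n => by rw [hϖM, ← exp_nsmul, nsmul_eq_mul, mul_neg, mul_one]
  have hY0 : Y ≠ 0 := fun h0 => pow_ne_zero b hvϖ0 (hYv.symm.trans (by rw [h0, Valuation.map_zero]))
  have hρY0 : ρ Y ≠ 0 := (map_ne_zero ρ).2 hY0
  have hΘY0 : Θ Y ≠ 0 := (map_ne_zero Θ).2 hY0
  have hΘρY0 : Θ (ρ Y) ≠ 0 := (map_ne_zero Θ).2 hρY0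
  have hα0 : α - ρ α ≠ 0 := fun h0 => by rw [h0, map_zero] at hU; exact zero_ne_one hU
  have hcc0 : cc ≠ 0 := fun h0 => pow_ne_zero b hvϖ0 (hccv.symm.trans (by rw [h0, Valuation.map_zero]))
  have hρα : ρ (α - ρ α) = -(α - ρ α) := by rw [map_sub, hρρ]; ring
  -- the discreteness step `x < |ϖM|^n ↔ x ≤ |ϖM|^{n+1}`
  have hdisc : ∀ (x : ℤᵐ⁰) (n : ℕ), x < Valued.v ϖM ^ n ↔ x ≤ Valued.v ϖM ^ (n + 1) := by
    intro x n
    have hn : -(((n + 1 : ℕ) : ℤ)) + 1 = -(n : ℤ) := by push_cast; omega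
    rw [hπn, hπn, ← lt_mul_exp_iff_le exp_ne_zero, ← exp_add, hn]
  -- the two numerators
  set N₁ : M := μ * ρ Y - ρ μ * Y with hN₁
  set N₂ : M := μ * Θ (ρ Y) - ρ μ * Θ Y with hN₂
  have hdiff : Valued.v (N₂ - N₁) ≤ Valued.v ϖM ^ (3 * b + 1) := by
    have e : N₂ - N₁ = μ * ρ (Θ Y - Y) - ρ μ * (Θ Y - Y) := by rw [hN₁, hN₂, map_sub, ← hΘρ]; ring
    have hb' : Valued.v (Θ Y - Y) ≤ Valued.v ϖM ^ (b + 1) := by rw [pow_succ, ← hYv]; exact hΘY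
    rw [e]
    refine (Valuation.map_sub _ _ _).trans (max_le ?_ ?_)
    · rw [Valuation.map_mul, hvρ, hμv, show 3 * b + 1 = 2 * b + (b + 1) by ring, pow_add]; gcongr
    · rw [Valuation.map_mul, hvρ, hμv, show 3 * b + 1 = 2 * b + (b + 1) by ring, pow_add]; gcongr
  have hswap : Valued.v N₁ < Valued.v ϖM ^ (3 * b) ↔ Valued.v N₂ < Valued.v ϖM ^ (3 * b) := by
    have hlt : Valued.v (N₂ - N₁) < Valued.v ϖM ^ (3 * b) := (hdisc _ _).2 hdiff
    constructor
    · intro h1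
      have e : N₂ = N₁ + (N₂ - N₁) := by ring
      rw [e]; exact lt_of_le_of_lt (Valuation.map_add _ _ _) (max_lt h1 hlt)
    · intro h2
      have e : N₁ = N₂ - (N₂ - N₁) := by ring
      rw [e]; exact lt_of_le_of_lt (Valuation.map_sub _ _ _) (max_lt h2 hlt)
  -- LEFT: the order clause is `|N₁| ≤ |cc(α − ρα)|·|ϖM·Y·ρY| = |ϖM|^{3b+1}`
  have hL : IsOrd ρ α cc (μ / (ϖM * Y)) ↔ Valued.v N₁ ≤ Valued.v ϖM ^ (3 * b + 1) := by
    have hz1 : Valued.v (μ / (ϖM * Y)) ≤ 1 := by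
      rw [map_div₀, Valuation.map_mul, hμv, hYv, ← pow_succ', div_le_one₀ (pow_pos hvϖpos _)]
      exact pow_le_pow_right_of_le_one' hϖle (by omega)
    have hid : μ / (ϖM * Y) - ρ (μ / (ϖM * Y)) = N₁ / (ϖM * (Y * ρ Y)) := by
      rw [map_div₀, map_mul, hρϖ, hN₁]; field_simp
    rw [isOrd_iff, and_iff_right hz1, hid, map_div₀, Valuation.map_mul, Valuation.map_mul, hvρ, hYv, Valuation.map_mul, hccv, hU, mul_one,
      div_le_iff₀ (mul_pos hvϖpos (mul_pos (pow_pos hvϖpos _) (pow_pos hvϖpos _)))]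
    rw [show 3 * b + 1 = b + (1 + (b + b)) by ring, pow_add, pow_add, pow_add, pow_one]
  -- RIGHT: the trace is `N₂ ∕ (cc(α − ρα)·ΘY·Θ(ρY))`, of denominator size `|ϖM|^{3b}`
  have hR : Valued.v (μ / (cc * (α - ρ α) * Θ Y) + ρ (μ / (cc * (α - ρ α) * Θ Y))) < 1 ↔ Valued.v N₂ < Valued.v ϖM ^ (3 * b) := by
    have hid : μ / (cc * (α - ρ α) * Θ Y) + ρ (μ / (cc * (α - ρ α) * Θ Y)) = N₂ / (cc * (α - ρ α) * (Θ Y * Θ (ρ Y))) := by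
      rw [map_div₀, map_mul, map_mul, hρcc, hρα, ← hΘρ, hN₂]; field_simp; ring
    rw [hid, map_div₀, Valuation.map_mul, Valuation.map_mul, Valuation.map_mul, hvΘ, hvΘ, hvρ, hccv, hU, hYv, mul_one,
      div_lt_one₀ (mul_pos (pow_pos hvϖpos _) (mul_pos (pow_pos hvϖpos _) (pow_pos hvϖpos _)))]
    rw [show 3 * b = b + (b + b) by ring, pow_add, pow_add]
  rw [hL, hR, ← hdisc, hswap]

/-! ## §2 The two square clauses with the boundary letter (★ p863084 §3 at exponent `b`) -/

/-- **THE SQUARE CLAUSE `(lam − 1)² ∕ ϖE^k ∈ 𝒪_cc`** with the BOUNDARY letter `|μ − ρμ| ≤ |cc(α − ρα)|·|ϖE|^b` (★ p863084 `isOrd_sq_div_of_row` has `b + 1`), `|μ| ≤ |ϖE|^{2b}`,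
`|u₀₀ − 1| ≤ |ϖ|^{n_u}`, `k ≤ 2b`, `k ≤ 2n_u`, `k ≤ b + n_u`. [cite: Serre1979, Ch. III §6 Prop. 12] [cite: Kottwitz1986BaseChangeUnits, §3] -/
theorem isOrd_sq_div_of_antiRow
    (hvρ : ∀ x, Valued.v (ρ x) = Valued.v x)
    (jE : E →+* M) (hjv : ∀ c, Valued.v (jE c) ≤ 1 ↔ Valued.v c ≤ 1) (hjfix : ∀ z, ρ z = z ↔ ∃ c, jE c = z)
    {ϖ : E} (hϖ : Valued.v ϖ = exp (-1 : ℤ))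
    {cc lam : M} {u₀ : E} {b nu k : ℕ} (hum : Valued.v (u₀ - 1) ≤ Valued.v ϖ ^ nu)
    (hμ : Valued.v (lam - jE u₀) ≤ Valued.v (jE ϖ) ^ (2 * b))
    (hanti : Valued.v ((lam - jE u₀) - ρ (lam - jE u₀)) ≤ Valued.v (cc * (α - ρ α)) * Valued.v (jE ϖ) ^ b)
    (hk2b : k ≤ 2 * b) (hk2u : k ≤ 2 * nu) (hkbu : k ≤ b + nu) :
    IsOrd ρ α cc ((lam - 1) ^ 2 / jE ϖ ^ k) := by
  obtain ⟨hϖ0, hϖlt, hjϖ0, hvjϖ0, hvjϖpos, hjϖlt, hjϖle⟩ := uniformizer_letters jE hjv hϖ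
  have hρϖ : ρ (jE ϖ) = jE ϖ := (hjfix _).2 ⟨ϖ, rfl⟩
  have hρu : ρ (jE u₀) = jE u₀ := (hjfix _).2 ⟨_, rfl⟩
  have hjum : Valued.v (jE u₀ - 1) ≤ Valued.v (jE ϖ) ^ nu := by simpa only [map_sub, map_one] using v_map_le_map_pow_of_le jE hjv hϖ0 hum
  have hsplit : lam - 1 = (lam - jE u₀) + (jE u₀ - 1) := by ring
  -- `|lam − 1| ≤ |ϖE|^e` with `2e ≥ k` and `b + e ≥ k`
  obtain ⟨e, hl1, hke, hkbe⟩ : ∃ e : ℕ, Valued.v (lam - 1) ≤ Valued.v (jE ϖ) ^ e ∧ k ≤ 2 * e ∧ k ≤ b + e := by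
    rcases le_total (Valued.v (jE ϖ) ^ (2 * b)) (Valued.v (jE ϖ) ^ nu) with hle | hle
    · refine ⟨nu, ?_, hk2u, hkbu⟩
      rw [hsplit]; exact (Valuation.map_add _ _ _).trans (max_le (hμ.trans hle) hjum)
    · refine ⟨2 * b, ?_, by omega, by omega⟩
      rw [hsplit]; exact (Valuation.map_add _ _ _).trans (max_le hμ (hjum.trans hle))
  have hρl1 : Valued.v (ρ lam - 1) ≤ Valued.v (jE ϖ) ^ e := by rw [show ρ lam - 1 = ρ (lam - 1) by rw [map_sub, map_one], hvρ]; exact hl1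
  have hantil : Valued.v (lam - ρ lam) ≤ Valued.v (cc * (α - ρ α)) * Valued.v (jE ϖ) ^ b := by
    have e1 : (lam - jE u₀) - ρ (lam - jE u₀) = lam - ρ lam := by rw [map_sub, hρu]; ring
    rw [← e1]; exact hanti
  refine ⟨?_, ?_⟩
  · rw [Valuation.map_div, Valuation.map_pow, Valuation.map_pow, div_le_one₀ (pow_pos hvjϖpos _)]
    calc Valued.v (lam - 1) ^ 2 ≤ (Valued.v (jE ϖ) ^ e) ^ 2 := pow_le_pow_left₀ zero_le hl1 2
      _ = Valued.v (jE ϖ) ^ (2 * e) := by rw [← pow_mul, mul_comm]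
      _ ≤ Valued.v (jE ϖ) ^ k := pow_le_pow_right_of_le_one' hjϖle hke
  · have hid : (lam - 1) ^ 2 / jE ϖ ^ k - ρ ((lam - 1) ^ 2 / jE ϖ ^ k) = (lam - ρ lam) * ((lam - 1) + (ρ lam - 1)) / jE ϖ ^ k := by
      rw [map_div₀, map_pow, map_pow, hρϖ, map_sub, map_one]
      field_simp
      ring
    rw [hid, Valuation.map_div, Valuation.map_pow, Valuation.map_mul, div_le_iff₀ (pow_pos hvjϖpos _)]
    have htr : Valued.v ((lam - 1) + (ρ lam - 1)) ≤ Valued.v (jE ϖ) ^ e := (Valuation.map_add _ _ _).trans (max_le hl1 hρl1)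
    calc Valued.v (lam - ρ lam) * Valued.v ((lam - 1) + (ρ lam - 1))
        ≤ Valued.v (cc * (α - ρ α)) * Valued.v (jE ϖ) ^ b * Valued.v (jE ϖ) ^ e := mul_le_mul' hantil htr
      _ = Valued.v (cc * (α - ρ α)) * Valued.v (jE ϖ) ^ (b + e) := by rw [mul_assoc, ← pow_add]
      _ ≤ Valued.v (cc * (α - ρ α)) * Valued.v (jE ϖ) ^ k := mul_le_mul_right (pow_le_pow_right_of_le_one' hjϖle hkbe) _

/-- **THE SQUARE CLAUSE `((lam − 1)² − (jE u₀₀ − 1)²) ∕ (ϖE^k·Y) ∈ 𝒪_cc`** with the BOUNDARY letter (exponent `b`; ★ p863084 `isOrd_sqDiff_div_of_row` has `b + 1` and a digit to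
spare), `Y ∈ 𝒪_cc`, `|Y| = |ϖE|^b`, `|μ| ≤ |ϖE|^{2b}`, `|u₀₀ − 1| ≤ |ϖ|^{n_u}`, `|2| ≤ |ϖ|^t`, `k ≤ 2b`, `k ≤ t + n_u`. [cite: Serre1979, Ch. III §6 Prop. 12] [cite: Jacobowitz1962, §4] -/
theorem isOrd_sqDiff_div_of_antiRow
    (hvρ : ∀ x, Valued.v (ρ x) = Valued.v x)
    (jE : E →+* M) (hjv : ∀ c, Valued.v (jE c) ≤ 1 ↔ Valued.v c ≤ 1) (hjfix : ∀ z, ρ z = z ↔ ∃ c, jE c = z)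
    {ϖ : E} (hϖ : Valued.v ϖ = exp (-1 : ℤ)) {t : ℕ} (h2 : Valued.v (2 : E) ≤ Valued.v ϖ ^ t)
    {cc Y : M} (hYO : IsOrd ρ α cc Y) {b : ℕ} (hYb : Valued.v Y = Valued.v (jE ϖ) ^ b)
    {lam : M} {u₀ : E} {nu k : ℕ} (hum : Valued.v (u₀ - 1) ≤ Valued.v ϖ ^ nu)
    (hμ : Valued.v (lam - jE u₀) ≤ Valued.v (jE ϖ) ^ (2 * b))
    (hanti : Valued.v ((lam - jE u₀) - ρ (lam - jE u₀)) ≤ Valued.v (cc * (α - ρ α)) * Valued.v (jE ϖ) ^ b)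
    (hk2b : k ≤ 2 * b) (hktu : k ≤ t + nu) :
    IsOrd ρ α cc (((lam - 1) ^ 2 - (jE u₀ - 1) ^ 2) / (jE ϖ ^ k * Y)) := by
  obtain ⟨hϖ0, hϖlt, hjϖ0, hvjϖ0, hvjϖpos, hjϖlt, hjϖle⟩ := uniformizer_letters jE hjv hϖ
  have hρϖ : ρ (jE ϖ) = jE ϖ := (hjfix _).2 ⟨ϖ, rfl⟩
  have hρu : ρ (jE u₀) = jE u₀ := (hjfix _).2 ⟨_, rfl⟩
  have hY0 : Y ≠ 0 := fun h0 => pow_ne_zero b hvjϖ0 (hYb.symm.trans (by rw [h0, Valuation.map_zero]))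
  have hρY0 : ρ Y ≠ 0 := (map_ne_zero ρ).2 hY0
  -- the numerator `μ·w`
  set μ : M := lam - jE u₀ with hμdef
  set w : M := μ + 2 * (jE u₀ - 1) with hwdef
  have hnum : (lam - 1) ^ 2 - (jE u₀ - 1) ^ 2 = μ * w := by rw [hwdef, hμdef]; ring
  have h2u : Valued.v (2 * (jE u₀ - 1)) ≤ Valued.v (jE ϖ) ^ (t + nu) := by
    have h := v_map_le_map_pow_of_le jE hjv hϖ0 (x := 2 * (u₀ - 1)) (m := t + nu)
      (by rw [Valuation.map_mul, pow_add]; exact mul_le_mul' h2 hum)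
    rwa [map_mul, map_sub, map_one, map_ofNat] at h
  have hvw : Valued.v w ≤ Valued.v (jE ϖ) ^ k := by
    rw [hwdef]
    refine (Valuation.map_add _ _ _).trans (max_le ?_ ?_)
    · exact hμ.trans (pow_le_pow_right_of_le_one' hjϖle hk2b)
    · exact h2u.trans (pow_le_pow_right_of_le_one' hjϖle hktu)
  have hwρ : w - ρ w = μ - ρ μ := by
    simp only [hwdef, hμdef, map_add, map_sub, map_mul, map_ofNat, map_one, hρu]; ring
  refine ⟨?_, ?_⟩
  · rw [hnum, Valuation.map_div, Valuation.map_mul, Valuation.map_mul, Valuation.map_pow, hYb,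
      div_le_one₀ (mul_pos (pow_pos hvjϖpos _) (pow_pos hvjϖpos _))]
    calc Valued.v μ * Valued.v w ≤ Valued.v (jE ϖ) ^ (2 * b) * Valued.v (jE ϖ) ^ k := mul_le_mul' hμ hvw
      _ ≤ Valued.v (jE ϖ) ^ b * Valued.v (jE ϖ) ^ k := mul_le_mul_left (pow_le_pow_right_of_le_one' hjϖle (by omega)) _
      _ = Valued.v (jE ϖ) ^ k * Valued.v (jE ϖ) ^ b := mul_comm _ _
  · -- `μw∕(ϖ^kY) − ρ(…) = (μw·ρY − ρ(μw)·Y)∕(ϖ^k·Y·ρY)` and `μw·ρY − ρ(μw)·Y = μw·(ρY − Y) + (μ(w − ρw) + (μ − ρμ)ρw)·Y`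
    have hid : μ * w / (jE ϖ ^ k * Y) - ρ (μ * w / (jE ϖ ^ k * Y)) =
        (μ * w * (ρ Y - Y) + (μ * (w - ρ w) + (μ - ρ μ) * ρ w) * Y) / (jE ϖ ^ k * (Y * ρ Y)) := by
      rw [map_div₀, map_mul, map_mul, map_pow, hρϖ]
      field_simp
      ring
    rw [hnum, hid, Valuation.map_div, Valuation.map_mul, Valuation.map_mul, Valuation.map_pow, hvρ, hYb,
      div_le_iff₀ (mul_pos (pow_pos hvjϖpos _) (mul_pos (pow_pos hvjϖpos _) (pow_pos hvjϖpos _)))]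
    have hρYsub : Valued.v (ρ Y - Y) ≤ Valued.v (cc * (α - ρ α)) := by
      rw [← Valuation.map_neg, neg_sub]; exact hYO.2
    have hA : Valued.v (μ * w * (ρ Y - Y)) ≤ Valued.v (jE ϖ) ^ (2 * b) * Valued.v (jE ϖ) ^ k * Valued.v (cc * (α - ρ α)) := by
      rw [Valuation.map_mul, Valuation.map_mul]
      exact mul_le_mul' (mul_le_mul' hμ hvw) hρYsub
    have hB : Valued.v ((μ * (w - ρ w) + (μ - ρ μ) * ρ w) * Y) ≤
        Valued.v (cc * (α - ρ α)) * Valued.v (jE ϖ) ^ b * Valued.v (jE ϖ) ^ k * Valued.v (jE ϖ) ^ b := by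
      rw [Valuation.map_mul, hYb]
      refine mul_le_mul_left ((Valuation.map_add _ _ _).trans (max_le ?_ ?_)) _
      · rw [hwρ, Valuation.map_mul, mul_comm]
        calc Valued.v (μ - ρ μ) * Valued.v μ ≤ Valued.v (cc * (α - ρ α)) * Valued.v (jE ϖ) ^ b * Valued.v (jE ϖ) ^ (2 * b) := mul_le_mul' hanti hμ
          _ ≤ Valued.v (cc * (α - ρ α)) * Valued.v (jE ϖ) ^ b * Valued.v (jE ϖ) ^ k :=
              mul_le_mul_right (pow_le_pow_right_of_le_one' hjϖle hk2b) _
      · rw [Valuation.map_mul, hvρ]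
        exact mul_le_mul' hanti hvw
    calc Valued.v (μ * w * (ρ Y - Y) + (μ * (w - ρ w) + (μ - ρ μ) * ρ w) * Y)
        ≤ max (Valued.v (jE ϖ) ^ (2 * b) * Valued.v (jE ϖ) ^ k * Valued.v (cc * (α - ρ α)))
            (Valued.v (cc * (α - ρ α)) * Valued.v (jE ϖ) ^ b * Valued.v (jE ϖ) ^ k * Valued.v (jE ϖ) ^ b) :=
          (Valuation.map_add _ _ _).trans (max_le_max hA hB)
      _ ≤ Valued.v (cc * (α - ρ α)) * (Valued.v (jE ϖ) ^ k * (Valued.v (jE ϖ) ^ b * Valued.v (jE ϖ) ^ b)) := by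
          refine max_le ?_ ?_
          · rw [show Valued.v (jE ϖ) ^ (2 * b) * Valued.v (jE ϖ) ^ k * Valued.v (cc * (α - ρ α)) =
                Valued.v (cc * (α - ρ α)) * (Valued.v (jE ϖ) ^ k * (Valued.v (jE ϖ) ^ b * Valued.v (jE ϖ) ^ b)) by rw [two_mul, pow_add]; ac_rfl]
          · rw [show Valued.v (cc * (α - ρ α)) * Valued.v (jE ϖ) ^ b * Valued.v (jE ϖ) ^ k * Valued.v (jE ϖ) ^ b =
                Valued.v (cc * (α - ρ α)) * (Valued.v (jE ϖ) ^ k * (Valued.v (jE ϖ) ^ b * Valued.v (jE ϖ) ^ b)) by ac_rfl]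

/-! ## §3 `(lam − 1) ∕ ϖE` lies in the order -/

/-- **`(lam − 1)∕ϖE ∈ 𝒪_cc` AT DEPTH**: `|μ| ≤ |ϖE|^{2b}`, `|u₀₀ − 1| ≤ |ϖ|^{n_u}`, `1 ≤ b`, `1 ≤ n_u`, and the boundary letter `|μ − ρμ| ≤ |cc(α − ρα)|·|ϖE|^b`.
[cite: Serre1979, Ch. III §6 Prop. 12] -/
theorem isOrd_sub_one_div_of_deep (jE : E →+* M) (hjv : ∀ c, Valued.v (jE c) ≤ 1 ↔ Valued.v c ≤ 1) (hjfix : ∀ z, ρ z = z ↔ ∃ c, jE c = z)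
    {ϖ : E} (hϖ : Valued.v ϖ = exp (-1 : ℤ))
    {cc lam : M} {u₀ : E} {b nu : ℕ} (hb1 : 1 ≤ b) (hnu1 : 1 ≤ nu) (hum : Valued.v (u₀ - 1) ≤ Valued.v ϖ ^ nu)
    (hμ : Valued.v (lam - jE u₀) ≤ Valued.v (jE ϖ) ^ (2 * b))
    (hanti : Valued.v ((lam - jE u₀) - ρ (lam - jE u₀)) ≤ Valued.v (cc * (α - ρ α)) * Valued.v (jE ϖ) ^ b) :
    IsOrd ρ α cc ((lam - 1) / jE ϖ) := by
  obtain ⟨hϖ0, hϖlt, hjϖ0, hvjϖ0, hvjϖpos, hjϖlt, hjϖle⟩ := uniformizer_letters jE hjv hϖ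
  have hρϖ : ρ (jE ϖ) = jE ϖ := (hjfix _).2 ⟨ϖ, rfl⟩
  have hρu : ρ (jE u₀) = jE u₀ := (hjfix _).2 ⟨_, rfl⟩
  have hjum : Valued.v (jE u₀ - 1) ≤ Valued.v (jE ϖ) ^ nu := by simpa only [map_sub, map_one] using v_map_le_map_pow_of_le jE hjv hϖ0 hum
  have hl1 : Valued.v (lam - 1) ≤ Valued.v (jE ϖ) := by
    rw [show lam - 1 = (lam - jE u₀) + (jE u₀ - 1) by ring]
    refine (Valuation.map_add _ _ _).trans (max_le (hμ.trans ?_) (hjum.trans ?_))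
    · exact (pow_le_pow_right_of_le_one' hjϖle (by omega : 1 ≤ 2 * b)).trans (le_of_eq (pow_one _))
    · exact (pow_le_pow_right_of_le_one' hjϖle hnu1).trans (le_of_eq (pow_one _))
  refine ⟨?_, ?_⟩
  · rw [map_div₀, div_le_one₀ hvjϖpos]; exact hl1
  · have hid : (lam - 1) / jE ϖ - ρ ((lam - 1) / jE ϖ) = ((lam - jE u₀) - ρ (lam - jE u₀)) / jE ϖ := by
      rw [map_div₀, hρϖ, map_sub, map_one, map_sub, hρu]; ring
    rw [hid, map_div₀, div_le_iff₀ hvjϖpos]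
    refine hanti.trans (mul_le_mul_right ?_ _)
    calc Valued.v (jE ϖ) ^ b ≤ Valued.v (jE ϖ) ^ 1 := pow_le_pow_right_of_le_one' hjϖle hb1
      _ = Valued.v (jE ϖ) := pow_one _

/-! ## §4 HEADS — the `(0, k)`-shell off the X-digit; level `1` (no shell) on it -/

/-- **HEAD — «AT δ = 0, OFF THE X-DIGIT, A DIAGONAL-CELL VERTEX IS ON THE `(0, k)`-SHELL».**  ★ p863084 HEAD's frame with the boundary letter `hanti` (exponent `b`), `ρ cc = cc`,
`|cc| = |ϖE|^b`, `1 ≤ b`, a second involution `Θ` commuting with `ρ` carrying the RamK datum `IsRamifiedQuadraticDatum Θ (jE ϖ) d t_M` with `2 ≤ d`, and the letter scalar NOT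
dropping: `¬ |μ∕D₀ + ρ(μ∕D₀)| < 1`, `D₀ = cc(α − ρα)·ΘY`; square level `k ≤ 2b`, `k ≤ 2n_u`, `k ≤ b + n_u`, `k ≤ t + n_u`.  THEN `LatticeNearTransvShell ϖ 0 k (Γ − 1) L`.
[cite: Kottwitz1986BaseChangeUnits, §3] [cite: Serre1979, Ch. III §6 Prop. 12; Ch. IV §1 Prop. 3] [cite: Jacobowitz1962, §4] [cite: Rogawski1990, §4.9 Prop. 4.9.1 (b) p. 55] -/
theorem latticeNearTransvShell_zero_of_gap_zero
    (hρρ : ∀ x, ρ (ρ x) = x) (hvρ : ∀ x, Valued.v (ρ x) = Valued.v x) (hΘρ : ∀ x, Θ (ρ x) = ρ (Θ x)) (hα : ρ α ≠ α) (hα1 : Valued.v α ≤ 1)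
    (hU : Valued.v (α - ρ α) = 1)
    {ϖ : E} (hϖ : Valued.v ϖ = exp (-1 : ℤ)) {t : ℕ} (h2 : Valued.v (2 : E) ≤ Valued.v ϖ ^ t)
    (jE : E →+* M) (hjv : ∀ c, Valued.v (jE c) ≤ 1 ↔ Valued.v c ≤ 1) (hjfix : ∀ z, ρ z = z ↔ ∃ c, jE c = z)
    {d tM : ℕ} (hDM : IsRamifiedQuadraticDatum Θ (jE ϖ) d tM) (hd2 : 2 ≤ d)
    (φ : (Fin 2 → E) →+ M) (hφs : ∀ (c : E) (x : Fin 2 → E), φ (c • x) = jE c * φ x) (hφi : Function.Injective φ)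
    {γ₂ : GL (Fin 2) E} {lam : M} (hφγ : ∀ x, φ ((γ₂ : Matrix (Fin 2) (Fin 2) E) *ᵥ x) = lam * φ x)
    {L : Submodule 𝒪[E] (Fin 3 → E)} {b : ℕ} (hb : ∀ a : E, (Pi.single 1 a : Fin 3 → E) ∈ L ↔ Valued.v a ≤ Valued.v ϖ ^ b)
    (hpr : ∀ x ∈ L, Valued.v (x 1) * Valued.v ϖ ^ b ≤ 1)
    {B₂ : Submodule 𝒪[E] (Fin 2 → E)} {w₀ : Fin 2 → E} {g₀ : Fin 3 → E}
    (hB : B₂.map ((Matrix.toLin' (!![1, 0; 0, 0; 0, 1] : Matrix (Fin 3) (Fin 2) E)).restrictScalars 𝒪[E]) =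
      L ⊓ LinearMap.ker ((LinearMap.proj (1 : Fin 3) : (Fin 3 → E) →ₗ[E] E).restrictScalars 𝒪[E]))
    (hg₀ : g₀ ∈ L) (hg₀1 : Valued.v (g₀ 1) * Valued.v ϖ ^ b = 1) (hprg : g₀ - Pi.single 1 (g₀ 1) = ![w₀ 0, 0, w₀ 1])
    {Λ : AddSubgroup M} (hBΛ : B₂.toAddSubgroup.map φ = Λ) {cc x₀ Y : M} (hx₀ : x₀ ≠ 0)
    (hΛx : ∀ x, x ∈ Λ ↔ ∃ z, IsOrd ρ α cc z ∧ x = x₀ * z) (hw₀Y : φ w₀ = Y⁻¹ * x₀)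
    (hYO : IsOrd ρ α cc Y) (hb1 : 1 ≤ b) (hYb : Valued.v Y = Valued.v (jE ϖ) ^ b) (hρcc : ρ cc = cc) (hccv : Valued.v cc = Valued.v (jE ϖ) ^ b)
    (u : GL (Fin 1) E) {nu : ℕ} (hum : Valued.v ((u : Matrix (Fin 1) (Fin 1) E) 0 0 - 1) ≤ Valued.v ϖ ^ nu)
    (hμ : Valued.v (lam - jE ((u : Matrix (Fin 1) (Fin 1) E) 0 0)) = Valued.v (jE ϖ) ^ (2 * b))
    (hanti : Valued.v ((lam - jE ((u : Matrix (Fin 1) (Fin 1) E) 0 0)) - ρ (lam - jE ((u : Matrix (Fin 1) (Fin 1) E) 0 0))) ≤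
      Valued.v (cc * (α - ρ α)) * Valued.v (jE ϖ) ^ b)
    (htr : ¬ Valued.v ((lam - jE ((u : Matrix (Fin 1) (Fin 1) E) 0 0)) / (cc * (α - ρ α) * Θ Y) +
      ρ ((lam - jE ((u : Matrix (Fin 1) (Fin 1) E) 0 0)) / (cc * (α - ρ α) * Θ Y))) < 1)
    {k : ℕ} (hk2b : k ≤ 2 * b) (hk2u : k ≤ 2 * nu) (hkbu : k ≤ b + nu) (hktu : k ≤ t + nu) :
    LatticeNearTransvShell ϖ 0 k ((((endoGL (γ₂, u) : GL (Fin 3) E) : Matrix (Fin 3) (Fin 3) E) - 1)) L := by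
  obtain ⟨hϖ0, hϖlt, hjϖ0, hvjϖ0, hvjϖpos, hjϖlt, hjϖle⟩ := uniformizer_letters jE hjv hϖ
  obtain ⟨hΘΘ, hvΘ, hϖM, hfixM, hddM, -, -⟩ := hDM
  have hρϖ : ρ (jE ϖ) = jE ϖ := (hjfix _).2 ⟨ϖ, rfl⟩
  have hY0 : Y ≠ 0 := fun h0 => pow_ne_zero b hvjϖ0 (hYb.symm.trans (by rw [h0, Valuation.map_zero]))
  have hΘY : Valued.v (Θ Y - Y) ≤ Valued.v Y * Valued.v (jE ϖ) := by
    rw [Valuation.map_sub_swap]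
    refine (v_sub_map_le_mul_pow hΘΘ hvΘ hfixM hϖM hddM Y).trans (mul_le_mul_right ?_ _)
    exact (pow_le_pow_right_of_le_one' hjϖle (by omega : 1 ≤ d - 1)).trans (le_of_eq (pow_one _))
  -- letters weakened to the forms the clauses want
  have hu1 : Valued.v ((u : Matrix (Fin 1) (Fin 1) E) 0 0 - 1) ≤ 1 := hum.trans (pow_le_one₀ zero_le hϖlt.le)
  have hμ1 : Valued.v (lam - jE ((u : Matrix (Fin 1) (Fin 1) E) 0 0)) ≤ 1 := hμ.le.trans (pow_le_one₀ zero_le hjϖle)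
  have hanti0 : Valued.v ((lam - jE ((u : Matrix (Fin 1) (Fin 1) E) 0 0)) - ρ (lam - jE ((u : Matrix (Fin 1) (Fin 1) E) 0 0))) ≤
      Valued.v (cc * (α - ρ α)) :=
    hanti.trans (mul_le_of_le_one_right' (pow_le_one₀ zero_le hjϖle))
  rw [latticeNearTransvShell_endoGL_sub_one_iff_isOrd hvρ hϖ jE φ hφs hφi hφγ hb hpr hB hg₀ hg₀1 hprg hBΛ hx₀ hY0 hΛx hw₀Y u 0 k,
    pow_zero, pow_zero, div_one, one_mul, zero_add, pow_one, pow_one]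
  refine ⟨⟨hu1.trans (le_of_eq (Valuation.map_one _).symm), ?_, ?_⟩, ?_, ⟨?_, ?_, ?_⟩⟩
  · exact isOrd_sub_one_of_row (α := α) jE hjv hjfix hu1 hμ1 hanti0
  · exact isOrd_div_of_row hvρ hα hα1 jE hjv hϖ hYO hYb (le_of_eq hccv) hμ.le hanti
  · exact fun h => htr ((isOrd_div_mul_iff_v_trace_lt_one hρρ hvρ hΘρ hvΘ hρϖ hϖM hρcc hb1 hccv hU hYb hΘY hμ).1 h.2.2)
  · rw [Valuation.map_pow, Valuation.map_pow]
    calc Valued.v ((u : Matrix (Fin 1) (Fin 1) E) 0 0 - 1) ^ 2 ≤ (Valued.v ϖ ^ nu) ^ 2 := pow_le_pow_left₀ zero_le hum 2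
      _ = Valued.v ϖ ^ (2 * nu) := by rw [← pow_mul, mul_comm]
      _ ≤ Valued.v ϖ ^ k := pow_le_pow_right_of_le_one' hϖlt.le hk2u
  · exact isOrd_sq_div_of_antiRow hvρ jE hjv hjfix hϖ hum hμ.le hanti hk2b hk2u hkbu
  · exact isOrd_sqDiff_div_of_antiRow hvρ jE hjv hjfix hϖ h2 hYO hYb hum hμ.le hanti hk2b hktu

/-- **«AT δ = 0, ON THE X-DIGIT, A DIAGONAL-CELL VERTEX LIES IN LEVEL 1»** (hence on NO `(0, k)`-shell — next): the frame of the HEAD minus the square-level letters, with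
`1 ≤ n_u` and the letter scalar DROPPING `|μ∕D₀ + ρ(μ∕D₀)| < 1`.  THEN `LatticeInLevel ϖ 1 (Γ − 1) L` (★ `latticeInLevel_endoGL_sub_one_iff_isOrd` at `ℓ = 1`: the unit
clause from `|u₀₀ − 1| ≤ |ϖ|^{n_u}`, §3, and §1). [cite: Kottwitz1986BaseChangeUnits, §3] [cite: Serre1979, Ch. III §6 Prop. 12; Ch. IV §1 Prop. 3] [cite: Jacobowitz1962, §4] -/
theorem latticeInLevel_one_of_gap_zero
    (hρρ : ∀ x, ρ (ρ x) = x) (hvρ : ∀ x, Valued.v (ρ x) = Valued.v x) (hΘρ : ∀ x, Θ (ρ x) = ρ (Θ x)) (hU : Valued.v (α - ρ α) = 1)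
    {ϖ : E} (hϖ : Valued.v ϖ = exp (-1 : ℤ))
    (jE : E →+* M) (hjv : ∀ c, Valued.v (jE c) ≤ 1 ↔ Valued.v c ≤ 1) (hjfix : ∀ z, ρ z = z ↔ ∃ c, jE c = z)
    {d tM : ℕ} (hDM : IsRamifiedQuadraticDatum Θ (jE ϖ) d tM) (hd2 : 2 ≤ d)
    (φ : (Fin 2 → E) →+ M) (hφs : ∀ (c : E) (x : Fin 2 → E), φ (c • x) = jE c * φ x) (hφi : Function.Injective φ)
    {γ₂ : GL (Fin 2) E} {lam : M} (hφγ : ∀ x, φ ((γ₂ : Matrix (Fin 2) (Fin 2) E) *ᵥ x) = lam * φ x)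
    {L : Submodule 𝒪[E] (Fin 3 → E)} {b : ℕ} (hb : ∀ a : E, (Pi.single 1 a : Fin 3 → E) ∈ L ↔ Valued.v a ≤ Valued.v ϖ ^ b)
    (hpr : ∀ x ∈ L, Valued.v (x 1) * Valued.v ϖ ^ b ≤ 1)
    {B₂ : Submodule 𝒪[E] (Fin 2 → E)} {w₀ : Fin 2 → E} {g₀ : Fin 3 → E}
    (hB : B₂.map ((Matrix.toLin' (!![1, 0; 0, 0; 0, 1] : Matrix (Fin 3) (Fin 2) E)).restrictScalars 𝒪[E]) =
      L ⊓ LinearMap.ker ((LinearMap.proj (1 : Fin 3) : (Fin 3 → E) →ₗ[E] E).restrictScalars 𝒪[E]))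
    (hg₀ : g₀ ∈ L) (hg₀1 : Valued.v (g₀ 1) * Valued.v ϖ ^ b = 1) (hprg : g₀ - Pi.single 1 (g₀ 1) = ![w₀ 0, 0, w₀ 1])
    {Λ : AddSubgroup M} (hBΛ : B₂.toAddSubgroup.map φ = Λ) {cc x₀ Y : M} (hx₀ : x₀ ≠ 0)
    (hΛx : ∀ x, x ∈ Λ ↔ ∃ z, IsOrd ρ α cc z ∧ x = x₀ * z) (hw₀Y : φ w₀ = Y⁻¹ * x₀)
    (hb1 : 1 ≤ b) (hYb : Valued.v Y = Valued.v (jE ϖ) ^ b) (hρcc : ρ cc = cc) (hccv : Valued.v cc = Valued.v (jE ϖ) ^ b)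
    (u : GL (Fin 1) E) {nu : ℕ} (hnu1 : 1 ≤ nu) (hum : Valued.v ((u : Matrix (Fin 1) (Fin 1) E) 0 0 - 1) ≤ Valued.v ϖ ^ nu)
    (hμ : Valued.v (lam - jE ((u : Matrix (Fin 1) (Fin 1) E) 0 0)) = Valued.v (jE ϖ) ^ (2 * b))
    (hanti : Valued.v ((lam - jE ((u : Matrix (Fin 1) (Fin 1) E) 0 0)) - ρ (lam - jE ((u : Matrix (Fin 1) (Fin 1) E) 0 0))) ≤
      Valued.v (cc * (α - ρ α)) * Valued.v (jE ϖ) ^ b)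
    (htr : Valued.v ((lam - jE ((u : Matrix (Fin 1) (Fin 1) E) 0 0)) / (cc * (α - ρ α) * Θ Y) +
      ρ ((lam - jE ((u : Matrix (Fin 1) (Fin 1) E) 0 0)) / (cc * (α - ρ α) * Θ Y))) < 1) :
    LatticeInLevel ϖ 1 ((((endoGL (γ₂, u) : GL (Fin 3) E) : Matrix (Fin 3) (Fin 3) E) - 1)) L := by
  obtain ⟨hϖ0, hϖlt, hjϖ0, hvjϖ0, hvjϖpos, hjϖlt, hjϖle⟩ := uniformizer_letters jE hjv hϖ
  obtain ⟨hΘΘ, hvΘ, hϖM, hfixM, hddM, -, -⟩ := hDM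
  have hρϖ : ρ (jE ϖ) = jE ϖ := (hjfix _).2 ⟨ϖ, rfl⟩
  have hY0 : Y ≠ 0 := fun h0 => pow_ne_zero b hvjϖ0 (hYb.symm.trans (by rw [h0, Valuation.map_zero]))
  have hΘY : Valued.v (Θ Y - Y) ≤ Valued.v Y * Valued.v (jE ϖ) := by
    rw [Valuation.map_sub_swap]
    refine (v_sub_map_le_mul_pow hΘΘ hvΘ hfixM hϖM hddM Y).trans (mul_le_mul_right ?_ _)
    exact (pow_le_pow_right_of_le_one' hjϖle (by omega : 1 ≤ d - 1)).trans (le_of_eq (pow_one _))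
  rw [latticeInLevel_endoGL_sub_one_iff_isOrd hvρ hϖ jE φ hφs hφi hφγ hb hpr hB hg₀ hg₀1 hprg hBΛ hx₀ hY0 hΛx hw₀Y u 1, pow_one, pow_one]
  refine ⟨hum.trans ((pow_le_pow_right_of_le_one' hϖlt.le hnu1).trans (le_of_eq (pow_one _))), ?_, ?_⟩
  · exact isOrd_sub_one_div_of_deep jE hjv hjfix hϖ hb1 hnu1 hum hμ.le hanti
  · exact (isOrd_div_mul_iff_v_trace_lt_one hρρ hvρ hΘρ hvΘ hρϖ hϖM hρcc hb1 hccv hU hYb hΘY hμ).2 htr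

/-- **COROLLARY — «ON THE X-DIGIT THE VERTEX IS ON NO `(0, k)`-SHELL»** (the shell requires `¬ LatticeInLevel ϖ 1`). [cite: Kottwitz1986BaseChangeUnits, §3] -/
theorem not_latticeNearTransvShell_zero_of_latticeInLevel_one {ϖ : E} {X : Matrix (Fin 3) (Fin 3) E} {L : Submodule 𝒪[E] (Fin 3 → E)}
    (h1 : LatticeInLevel ϖ 1 X L) (k : ℕ) : ¬ LatticeNearTransvShell ϖ 0 k X L :=
  fun h => h.2.1 h1

end Summit.HodgeConjecture.HodgeConjecture.Cruxes.H413.F0P3cDyRamDiagonalCellShellsDeltaZero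

end
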